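import Mathlib
import Literature.LinearAlgebra.TensorNetworks.TensorTrainSVD
import Literature.LinearAlgebra.TensorNetworks.TensorTrainGauge
import Literature.LinearAlgebra.TensorNetworks.TensorTrainOrthogonal
import Literature.LinearAlgebra.TensorNetworks.TensorTrainRounding

/-!
# Right-to-left orthogonalisation of a tensor train, and TT-rounding of an arbitrary train

Oseledets, *Tensor-train decomposition*, SIAM J. Sci. Comput. 33 (2011), §3, Algorithm 2
("TT-rounding"), FIRST LOOP — the right-to-left orthogonalisation sweep — read (the paper is not
held, acquisition request acq-09604) through its restatement as Algorithm "Right-to-Left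
Orthogonalization" of Al Daas–Ballard–Cazeaux–Hallman–Międlar–Pasha–Reid–Saibaba, *Randomized
algorithms for rounding in the tensor-train format* (`DaasEtAl2021`, arXiv:2110.04393), §2.3
"Standard TT arithmetic": "To obtain a right orthogonal TT-tensor `Y` equivalent to `X`, we first
compute the thin QR factorization `[H(Y_N)ᵀ, R] = QR(H(X_N)ᵀ)` and set …
`V(Y_{N-1}) = V(X_{N-1}) Rᵀ` … This procedure is continued through cores `N-1, …, 2` but we do not
orthogonalize the first core"; "a tensor is right orthogonal if its horizontal unfoldings `H(X_n)`
have orthonormal rows for `n = 2, …, N`"; and as the first line `Y = OrthogonalizeRL(X)` of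
Algorithm "TT-Rounding" there.  Also: Uschmajew–Vandereycken, *Geometric methods on low-rank matrix
and tensor manifolds* (2020), §3.1 (24)–(25) ("by employing QR (resp. LQ) matrix decompositions in
every splitting step" one obtains `μ`-orthogonal decompositions; "a `μ`-orthogonal decomposition can
be obtained efficiently by manipulating cores in a … right-to-left sweep, where each step consists
of elementary matrix operations and QR decompositions"), Schollwöck, Ann. Phys. 326 (2011), §4.4.2
"Generation of a right-canonical MPS" (a sweep of SVD/QR steps from the right; §4.4.1: "Standard
QR, however, does not show us whether the matrices used are bigger than necessary … this would only
be possible using rank revealing QR" — the factorisation below IS rank-revealing), Holtz–Rohwedder–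
Schneider, *On manifolds of tensors of fixed TT-rank*, Numer. Math. 120, §3 (minimal, orthogonal TT
representations).  As in `TensorTrainSVD` / `TensorTrainRounding`, no theorem number of
[Oseledets2011] is asserted.

This is item #31 of the TT lane; it formalises the line "Not formalised here: the orthogonalisation
phase AS A QR SWEEP … for non-minimal trains the QR sweep also shrinks bonds" left open in
`TensorTrainRounding`, and thereby makes the guarantees of `TensorTrainRounding` unconditional:
they hold for `ttRound (localSvdSel rk) (rightOrthogonalize T)` for EVERY train `T` with at least
one site.

## The algorithm (orthogonalisation phase of Algorithm 2)

Input: any train `T : TensorTrain ℝ σ L`.  The sweep `TensorTrain.orthSweep` runs over the sites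
`k = L - 1, L - 2, …, 1` carrying an `r_k × r'_k` matrix `R` (initially, at the virtual site `L`,
the column vector `T.rbdry`, so that the last bond becomes `1`):
* form the LOCAL matrix `N = orthLocal (T.core k) R`, `N[α, (a, γ)] = (G_k(a) · R)[α, γ]` — the
  horizontal unfolding `H(G_k ×₃ R)` of the updated core (size `r_k × |σ|·r'_{k+1}`);
* factor `N = (N Wᵀ) W` with `W = rowBasis N`, a matrix with `rank N` ORTHONORMAL ROWS spanning the
  row space of `N` — the LQ step `[H(Y_n)ᵀ, R] = QR(H(Y_n)ᵀ)`, taken rank-revealing (`rank N` rows,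
  so redundant bond dimensions are trimmed; when `N` has full row rank this is the thin LQ
  factorisation up to the triangular shape of the left factor, which plays no role) and chosen by
  `Classical.choose` from `exists_transpose_mul_self_eq_one_mul_eq`, not by a numerical QR;
* the new core at site `k` is `W` reshaped, `G'_k(a)[β, γ] = W[β, (a, γ)]` (new bond
  `r'_k = rank N`); carry `R := N Wᵀ` to the site `k - 1` (`one step = TensorTrain.orthStep`);
finally (`TensorTrain.rightOrthogonalize`) the first core absorbs the last carried factor,
`G'_0(a) = G_0(a) · R_1`; the left bond `r_0` and the left boundary vector are kept.  Bond-dimension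
changes are realised, as in `TensorTrainSVD` / `TensorTrainRounding`, by rebuilding the train with
`TensorTrain.cons` (no casts between `Fin` types).

## Results

* THE SWEEP INVARIANT `TensorTrain.rightInterface_eq_orthSweep_mul`: `Q_k(T) = R_k · Q_0(B_k)` —
  the right interface of `T` at the bond `k` is the carried matrix times the right interface of the
  train `B_k` of processed sites, whose rows are orthonormal
  (`orthSweep_rightInterface_mul_transpose_self`); hence the new bond is
  `r'_k = rank Q_k(T)` (`orthSweep_r_zero_eq_rank`).
* `TensorTrain.rightOrthogonalize T`: same tensor (`eval_rightOrthogonalize`,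
  `evalUnfolding_rightOrthogonalize`), same `r_0` and left boundary vector, last bond `1`, right
  boundary vector `1`, RIGHT-ORTHONORMAL at every site `0 < j < L`
  (`rightOrthogonalize_core_mul_transpose_core`; interfaces:
  `rightOrthogonalize_rightInterface_mul_transpose_self`) — exactly the hypotheses of
  `TensorTrainRounding` — with interior bonds `r'_k = rank Q_k(T)` (`rightOrthogonalize_r_eq_rank`),
  so `rank T_⟨k⟩ ≤ r'_k ≤ r_k` (`rank_evalUnfolding_le_rightOrthogonalize_r`,
  `rightOrthogonalize_r_le`) and `r'_k = r_k` at a bond that is already minimal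
  (`rightOrthogonalize_r_eq_of_rank_eq`); the norm is read off the first core
  (`sum_sq_eval_eq_sum_sq_core_rightOrthogonalize`, how Algorithm 2 obtains `‖A‖_F` for its
  threshold).
* ALGORITHM 2 ON AN ARBITRARY TRAIN, `ttRound (localSvdSel rk) (rightOrthogonalize T)` (`0 < L`):
  the exact a-posteriori error identity (`sum_sq_sub_eval_ttRound_rightOrthogonalize_eq_loss`), the
  error bound by rank-`rk k` approximation errors / singular-value tails of the unfoldings `T_⟨k⟩`
  (`…_le`, `…_le_of_singularValues`: [OseledetsTyrtyshnikov2010, Thm 2.2; Oseledets2011, §2–§3] for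
  every input train), quasi-optimality `‖T - Y‖_F ≤ √(L-1) ‖T - T'‖_F` (`…_le_mul`), exactness below
  the caps (`eval_ttRound_rightOrthogonalize_eq`, `…_of_r_le`), bonds
  `≤ min (rk k) (rank Q_k(T)) ≤ min (rk k) (r_k)` (`ttRound_rightOrthogonalize_r_le`, `…_le_min`).
* TT-RECOMPRESSION `ttCompress T` (caps `= rank T_⟨k⟩`, `TensorTrain.ttRanks`): represents the same
  tensor (`eval_ttCompress`) with interior bonds EXACTLY the TT-ranks `rank T_⟨k⟩`
  (`ttCompress_r_eq_rank`), which no train of the same tensor beats (`ttCompress_r_le_of_eval_eq`):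
  the TT-ranks are attained, constructively from any representation [Oseledets2011, §3;
  HoltzRohwedderSchneider2011, §3; UschmajewVandereycken2020, Thm 12.2].

## Conventions and scope

Real scalars throughout (orthonormality is `W Wᵀ = 1`).  A train with no sites is returned
unchanged by `rightOrthogonalize`; the composition theorems carry `0 < L` (as `ttRound_r_last`).
Not formalised: the `ε`-threshold rank choice of Algorithm 2 (the rule is rank-capped, `rk` is an
input, as in `TensorTrainRounding`), operation counts, floating point; the LQ factorisation is an
existence statement (`Classical.choose`), its left factor is not asserted triangular.
-/

open Matrix Finset

namespace Literature.LinearAlgebra.TensorNetworks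

/-! ## An orthonormal basis of the row space (the `Q` of a rank-revealing LQ factorisation) -/

section RowSpace

variable {ρ τ : Type*} [Fintype ρ] [DecidableEq ρ] [Fintype τ]

/-- `rowBasis N`: a matrix `W` with `rank N` ORTHONORMAL ROWS spanning the row space of the real
matrix `N`, so that `N = (N Wᵀ) W` and `W Wᵀ = 1` — the factor `Q` of a (rank-revealing) LQ
factorisation `N = R Q`, `R = N Wᵀ` of full column rank; when `N` has full row rank this is the
thin LQ factorisation (the transposed thin QR factorisation of `Nᵀ`) up to the triangular shape of
`R`, which plays no role below ("rank revealing QR").  Chosen by `Classical.choose` from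
`exists_transpose_mul_self_eq_one_mul_eq` (an orthonormal basis of the column space of `Nᵀ`); the
number of rows is written `rank Nᵀ` (`= rank N`, `Matrix.rank_transpose`).
[cite: GolubVanLoan2013, §2.4.2] [cite: GolubVanLoan2013, §5.2]
[cite: Schollwoeck2011AnnPhys, §4.4.1] -/
noncomputable def rowBasis (N : Matrix ρ τ ℝ) : Matrix (Fin Nᵀ.rank) τ ℝ :=
  (Classical.choose (exists_transpose_mul_self_eq_one_mul_eq Nᵀ))ᵀ

/-- The rows of `rowBasis N` are orthonormal: `W Wᵀ = 1`.  [cite: GolubVanLoan2013, §2.4.2] -/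
theorem rowBasis_mul_transpose_self (N : Matrix ρ τ ℝ) : rowBasis N * (rowBasis N)ᵀ = 1 := by
  rw [rowBasis, Matrix.transpose_transpose]
  exact (Classical.choose_spec (exists_transpose_mul_self_eq_one_mul_eq Nᵀ)).1

/-- `N = (N Wᵀ) W`: the rows of `N` lie in the row space of `W = rowBasis N` (the LQ factorisation
`N = R Q` with `R = N Wᵀ`).  [cite: GolubVanLoan2013, §2.4.2] [cite: GolubVanLoan2013, §5.2] -/
theorem mul_transpose_rowBasis_mul_rowBasis (N : Matrix ρ τ ℝ) :
    N * (rowBasis N)ᵀ * rowBasis N = N := by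
  have h := congrArg Matrix.transpose
    (Classical.choose_spec (exists_transpose_mul_self_eq_one_mul_eq Nᵀ)).2
  rw [Matrix.transpose_mul, Matrix.transpose_mul, Matrix.transpose_transpose,
    Matrix.transpose_transpose] at h
  rw [rowBasis, Matrix.transpose_transpose]
  exact h

/-- The factor `R = N Wᵀ` has full column rank: `rank (N Wᵀ) = rank Nᵀ (= rank N)`, the number of
rows of `W`.  [cite: GolubVanLoan2013, §5.2] -/
theorem rank_mul_transpose_rowBasis (N : Matrix ρ τ ℝ) : (N * (rowBasis N)ᵀ).rank = Nᵀ.rank := by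
  refine le_antisymm ((Matrix.rank_le_card_width _).trans_eq (Fintype.card_fin _)) ?_
  calc Nᵀ.rank = N.rank := Matrix.rank_transpose N
    _ = (N * (rowBasis N)ᵀ * rowBasis N).rank := by rw [mul_transpose_rowBasis_mul_rowBasis]
    _ ≤ (N * (rowBasis N)ᵀ).rank := Matrix.rank_mul_le_left _ _

end RowSpace

/-- [folklore] Right multiplication by a matrix with orthonormal rows preserves the rank. -/
private theorem rank_mul_eq_of_mul_transpose_self {ρ κ τ : Type*} [Fintype κ] [DecidableEq κ]
    [Fintype τ] (R : Matrix ρ κ ℝ) (Q : Matrix κ τ ℝ) (hQ : Q * Qᵀ = 1) :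
    (R * Q).rank = R.rank := by
  refine le_antisymm (Matrix.rank_mul_le_left _ _) ?_
  calc R.rank = (R * Q * Qᵀ).rank := by rw [Matrix.mul_assoc, hQ, Matrix.mul_one]
    _ ≤ (R * Q).rank := Matrix.rank_mul_le_left _ _

namespace TensorTrain

/-! ## The right interfaces of an extended train -/

section ConsInterface

variable {K : Type*} [CommSemiring K] {σ : Type*} {n : ℕ} (T : TensorTrain K σ n) {r₀ r₁ : ℕ}
  (h : T.r 0 = r₁) (G : σ → Matrix (Fin r₀) (Fin r₁) K) (l : Fin r₀ → K)

/-- The tail vectors of the extended train `T.cons h G l` past its new first site are those of `T`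
(the two sides have definitionally equal types, `(T.cons h G l).r (k + 1) = T.r k`).
[cite: Oseledets2011, §2] -/
theorem tailVec_cons_succ : ∀ (m k : ℕ) (h₁ : k + 1 + m = n + 1) (t : Fin m → σ),
    (T.cons h G l).tailVec m (k + 1) h₁ t = T.tailVec m k (by omega) t
  | 0, _, _, _ => rfl
  | m + 1, k, h₁, t => by
      simp only [tailVec]
      rw [tailVec_cons_succ m (k + 1) (by omega) (Fin.tail t)]
      rfl

/-- The right interfaces of the extended train past its first site are those of the original train:
`Q_{k+1}(T.cons h G l) = Q_k(T)`.  [cite: UschmajewVandereycken2020, §3.1 (22)] -/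
theorem rightInterface_cons_succ (k m : ℕ) (h₁ : k + 1 + m = n + 1) :
    (T.cons h G l).rightInterface (k + 1) m h₁ = T.rightInterface k m (by omega) := by
  ext α t
  exact congrFun (T.tailVec_cons_succ h G l m k h₁ t) α

end ConsInterface

/-! ## The orthogonalisation sweep -/

section Orthogonalize

variable {σ : Type*}

/-- The LOCAL MATRIX of the orthogonalisation step at a site with core `G` and carried matrix `R`:
`orthLocal G R [α, (a, γ)] = (G(a) · R)[α, γ]` — the horizontal unfolding `H(G ×₃ R)` of the core
updated by the factor carried from the right, whose transposed QR (= LQ) factorisation the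
algorithm computes.  [cite: DaasEtAl2021, §2.3] [cite: Oseledets2011, §3, Alg. 2] -/
def orthLocal {r ρ q : ℕ} (G : σ → Matrix (Fin r) (Fin ρ) ℝ) (R : Matrix (Fin ρ) (Fin q) ℝ) :
    Matrix (Fin r) (σ × Fin q) ℝ :=
  Matrix.of fun α p => (G p.1 * R) α p.2

/-- Entries of the local matrix.  [cite: DaasEtAl2021, §2.3] -/
@[simp] theorem orthLocal_apply {r ρ q : ℕ} (G : σ → Matrix (Fin r) (Fin ρ) ℝ)
    (R : Matrix (Fin ρ) (Fin q) ℝ) (α : Fin r) (a : σ) (γ : Fin q) :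
    orthLocal G R α (a, γ) = (G a * R) α γ := rfl

variable [Fintype σ] {L : ℕ} (T : TensorTrain ℝ σ L)

/-- ONE STEP OF THE SWEEP, at the site `k`: given the train `B'` of the already processed sites
`k + 1, …, L - 1` and the carried `r_{k+1} × r'_{k+1}` matrix `R'` (as a dependent pair `P`), form
the local matrix `N = orthLocal G_k R'`, factor `N = (N Wᵀ) W` with `W = rowBasis N` (orthonormal
rows, `rank N` of them — the LQ step `[H(Y_n)ᵀ, R] = QR(H(Y_n)ᵀ)`), put the core `W` reshaped
(`B_0(a)[β, γ] = W[β, (a, γ)]`) in front of `B'`, and carry `N Wᵀ` (`V(Y_{n-1}) = V(X_{n-1}) Rᵀ` is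
performed when the next step forms its local matrix).  [cite: Oseledets2011, §3, Alg. 2]
[cite: DaasEtAl2021, §2.3, Alg. "Right-to-Left Orthogonalization"] -/
noncomputable def orthStep (k : ℕ) {m : ℕ}
    (P : (B : TensorTrain ℝ σ m) × Matrix (Fin (T.r (k + 1))) (Fin (B.r 0)) ℝ) :
    (B : TensorTrain ℝ σ (m + 1)) × Matrix (Fin (T.r k)) (Fin (B.r 0)) ℝ :=
  ⟨P.1.cons rfl (fun a => Matrix.of fun β γ => rowBasis (orthLocal (T.core k) P.2) β (a, γ))
      (fun _ => 1),
    orthLocal (T.core k) P.2 * (rowBasis (orthLocal (T.core k) P.2))ᵀ⟩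

/-- THE RIGHT-TO-LEFT ORTHOGONALISATION SWEEP over the sites `L - 1, L - 2, …, k` of `T`
(`m = L - k` of them), by recursion on `m`: it returns the train `B` of the `m` processed sites —
every core RIGHT-ORTHONORMAL, last bond `1`, boundary vectors `1` — together with the CARRIED
MATRIX `R` (`r_k × r'_k`, `r'_k = B.r 0` the new bond dimension) still to be absorbed at the site
`k - 1`, such that `Q_k(T) = R · Q_0(B)` (`rightInterface_eq_orthSweep_mul`).  The sweep starts
(`m = 0`) with the empty train and the column `rbdry` as carried matrix, so the last bond becomes
`1` whatever `r_L` was.  [cite: Oseledets2011, §3, Alg. 2]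
[cite: DaasEtAl2021, §2.3, Alg. "Right-to-Left Orthogonalization"]
[cite: Schollwoeck2011AnnPhys, §4.4.2] -/
noncomputable def orthSweep : (m k : ℕ) → k + m = L →
    (B : TensorTrain ℝ σ m) × Matrix (Fin (T.r k)) (Fin (B.r 0)) ℝ
  | 0, k, h => ⟨TensorTrain.nil 1 (fun _ => 1) (fun _ => 1),
      Matrix.of fun α _ => T.rbdry (α.cast (congrArg T.r h))⟩
  | m + 1, k, _ => T.orthStep k (orthSweep m (k + 1) (by omega))

section Step

variable (k : ℕ) {m : ℕ} (P : (B : TensorTrain ℝ σ m) × Matrix (Fin (T.r (k + 1))) (Fin (B.r 0)) ℝ)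

/-- The carried matrix after the step is `N Wᵀ`.  [cite: DaasEtAl2021, §2.3] -/
theorem orthStep_snd : (T.orthStep k P).2 =
    orthLocal (T.core k) P.2 * (rowBasis (orthLocal (T.core k) P.2))ᵀ := rfl

/-- The new bond is the rank of the local matrix.  [cite: UschmajewVandereycken2020, §3.1] -/
theorem orthStep_fst_r_zero : (T.orthStep k P).1.r 0 = (orthLocal (T.core k) P.2)ᵀ.rank := rfl

/-- The other bonds are those of `B'`.  [cite: Oseledets2011, §2] -/
theorem orthStep_fst_r_succ (j : ℕ) : (T.orthStep k P).1.r (j + 1) = P.1.r j := rfl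

/-- The new first core is `W = rowBasis N` reshaped.  [cite: DaasEtAl2021, §2.3] -/
theorem orthStep_fst_core_zero_apply (a : σ) (β : Fin ((T.orthStep k P).1.r 0))
    (γ : Fin ((T.orthStep k P).1.r 1)) :
    (T.orthStep k P).1.core 0 a β γ = rowBasis (orthLocal (T.core k) P.2) β (a, γ) := rfl

/-- The other cores are those of `B'`.  [cite: Oseledets2011, §2] -/
theorem orthStep_fst_core_succ (j : ℕ) (a : σ) : (T.orthStep k P).1.core (j + 1) a = P.1.core j a :=
  rfl

/-- Boundary data of the step's train.  [cite: Oseledets2011, §2] -/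
theorem orthStep_fst_lbdry : (T.orthStep k P).1.lbdry = fun _ => 1 := rfl

/-- Boundary data of the step's train.  [cite: Oseledets2011, §2] -/
theorem orthStep_fst_rbdry : (T.orthStep k P).1.rbdry = P.1.rbdry := rfl

omit [Fintype σ] in
/-- [folklore] reshaping a matrix with orthonormal rows and column index `σ × Fin q` into a core
`a ↦ W[·, (a, ·)]` gives a right-orthonormal core. -/
private theorem sum_reshape_mul_transpose_reshape [Fintype σ] {r q q' : ℕ}
    (W : Matrix (Fin r) (σ × Fin q) ℝ) (hW : W * Wᵀ = 1) (e : q' = q) :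
    ∑ a, (Matrix.of fun α (β : Fin q') =>
        (Matrix.of fun β' γ => W β' (a, γ) : Matrix (Fin r) (Fin q) ℝ) α (β.cast e)) *
      (Matrix.of fun α (β : Fin q') =>
        (Matrix.of fun β' γ => W β' (a, γ) : Matrix (Fin r) (Fin q) ℝ) α (β.cast e))ᵀ = 1 := by
  subst e
  ext α α'
  have h1 := congrFun (congrFun hW α) α'
  rw [Matrix.mul_apply, Fintype.sum_prod_type] at h1
  rw [Matrix.sum_apply]
  simp only [Matrix.mul_apply, Matrix.transpose_apply, Matrix.of_apply, Fin.cast_eq_self] at h1 ⊢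
  exact h1

/-- THE NEW CORE IS RIGHT-ORTHONORMAL: `∑ a, B_0(a) B_0(a)ᵀ = W Wᵀ = 1`.
[cite: DaasEtAl2021, §2.3, Alg. "Right-to-Left Orthogonalization"]
[cite: UschmajewVandereycken2020, §3.1 (25)] -/
theorem orthStep_fst_core_zero_mul_transpose :
    ∑ a, (T.orthStep k P).1.core 0 a * ((T.orthStep k P).1.core 0 a)ᵀ = 1 :=
  sum_reshape_mul_transpose_reshape _ (rowBasis_mul_transpose_self _) rfl

/-- Past its first site the right interfaces of the step's train are those of `B'`.
[cite: UschmajewVandereycken2020, §3.1 (22)] -/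
theorem orthStep_fst_rightInterface_succ (j n : ℕ) (h : j + 1 + n = m + 1) :
    (T.orthStep k P).1.rightInterface (j + 1) n h = P.1.rightInterface j n (by omega) :=
  P.1.rightInterface_cons_succ _ _ _ j n h

/-- ONE STEP OF THE SWEEP INVARIANT: if `Q_{k+1}(T) = R' · Q_0(B')` then
`Q_k(T) = (N Wᵀ) · Q_0(B)` for the step's output `(B, N Wᵀ)` — because
`Q_k(·, a t) = G_k(a) Q_{k+1}(·, t)`, `N = (N Wᵀ) W`, and `Q_0(B)(·, a t) = W(·, (a, ·)) Q_0(B')(·, t)`.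
[cite: Oseledets2011, §3, Alg. 2] [cite: DaasEtAl2021, §2.3] -/
theorem rightInterface_eq_orthStep_mul (h : k + (m + 1) = L)
    (ih : T.rightInterface (k + 1) m (by omega) = P.2 * P.1.rightInterface 0 m (Nat.zero_add m)) :
    T.rightInterface k (m + 1) h =
      (T.orthStep k P).2 * (T.orthStep k P).1.rightInterface 0 (m + 1) (Nat.zero_add _) := by
  ext α t
  obtain ⟨a, t, rfl⟩ : ∃ a t', t = Fin.cons a t' :=
    ⟨t 0, Fin.tail t, (Fin.cons_self_tail t).symm⟩
  rw [rightInterface_cons, ih, ← Matrix.mul_assoc, Matrix.mul_apply, Matrix.mul_apply]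
  simp only [rightInterface_cons, orthStep_fst_rightInterface_succ, orthStep_snd]
  set N := orthLocal (T.core k) P.2 with hN
  have hNW : ∀ γ, N α (a, γ) = ∑ β, (N * (rowBasis N)ᵀ) α β * rowBasis N β (a, γ) := fun γ => by
    rw [← Matrix.mul_apply, mul_transpose_rowBasis_mul_rowBasis]
  calc ∑ γ, (T.core k a * P.2) α γ * P.1.rightInterface 0 m (Nat.zero_add m) γ t
      = ∑ γ, (∑ β, (N * (rowBasis N)ᵀ) α β * rowBasis N β (a, γ)) *
          P.1.rightInterface 0 m (Nat.zero_add m) γ t :=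
        Finset.sum_congr rfl fun γ _ => by rw [← hNW γ]; rfl
    _ = ∑ β, (N * (rowBasis N)ᵀ) α β *
          ∑ γ, rowBasis N β (a, γ) * P.1.rightInterface 0 m (Nat.zero_add m) γ t := by
        simp only [Finset.sum_mul, Finset.mul_sum, mul_assoc]
        rw [Finset.sum_comm]
    _ = _ := by
        refine Finset.sum_congr rfl fun β _ => ?_
        rw [Matrix.mul_apply]
        rfl

end Step

/-- The sweep's train has left boundary vector `1`.  [cite: Oseledets2011, §3, Alg. 2] -/
theorem orthSweep_lbdry : ∀ (m k : ℕ) (h : k + m = L), (T.orthSweep m k h).1.lbdry = fun _ => 1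
  | 0, _, _ => rfl
  | _ + 1, _, _ => rfl

/-- The sweep's train has last bond dimension `1`.  [cite: Oseledets2011, §3, Alg. 2] -/
theorem orthSweep_r_last : ∀ (m k : ℕ) (h : k + m = L), (T.orthSweep m k h).1.r m = 1
  | 0, _, _ => rfl
  | m + 1, k, h => by
      rw [orthSweep]
      exact orthSweep_r_last m (k + 1) _

/-- The sweep's train has right boundary vector `1`.  [cite: Oseledets2011, §3, Alg. 2] -/
theorem orthSweep_rbdry : ∀ (m k : ℕ) (h : k + m = L), (T.orthSweep m k h).1.rbdry = fun _ => 1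
  | 0, _, _ => rfl
  | m + 1, k, h => by
      rw [orthSweep]
      exact orthSweep_rbdry m (k + 1) _

/-- EVERY CORE OF THE SWEEP'S TRAIN IS RIGHT-ORTHONORMAL: `∑ a, B_j(a) B_j(a)ᵀ = 1` for all
`j < m` (the horizontal unfoldings have orthonormal rows).
[cite: DaasEtAl2021, §2.3, Alg. "Right-to-Left Orthogonalization"] [cite: Oseledets2011, §3, Alg. 2]
[cite: UschmajewVandereycken2020, §3.1 (25)] -/
theorem orthSweep_core_mul_transpose_core : ∀ (m k : ℕ) (h : k + m = L) (j : ℕ), j < m →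
    ∑ a, (T.orthSweep m k h).1.core j a * ((T.orthSweep m k h).1.core j a)ᵀ = 1
  | 0, _, _, _, hj => absurd hj (Nat.not_lt_zero _)
  | m + 1, k, h, 0, _ => by
      rw [orthSweep]
      exact T.orthStep_fst_core_zero_mul_transpose k _
  | m + 1, k, h, j + 1, hj => by
      rw [orthSweep]
      exact orthSweep_core_mul_transpose_core m (k + 1) _ j (by omega)

/-- Hence every right interface of the sweep's train has orthonormal rows: `Q_j(B) Q_j(B)ᵀ = 1`.
[cite: UschmajewVandereycken2020, §3.1 (24)-(25)] -/
theorem orthSweep_rightInterface_mul_transpose_self (m k : ℕ) (h : k + m = L) (j n : ℕ)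
    (hjn : j + n = m) :
    (T.orthSweep m k h).1.rightInterface j n hjn * ((T.orthSweep m k h).1.rightInterface j n hjn)ᵀ =
      1 :=
  (T.orthSweep m k h).1.rightInterface_mul_transpose_self (T.orthSweep_r_last m k h)
    (T.orthSweep_rbdry m k h) n j hjn fun i _ hi => T.orthSweep_core_mul_transpose_core m k h i hi

/-- THE SWEEP INVARIANT (what the carried matrix is): `Q_k(T) = R · Q_0(B)` — the right interface
of `T` at the bond `k` is the carried matrix times the right interface of the sweep's train, whose
rows are orthonormal (`orthSweep_rightInterface_mul_transpose_self`): the sweep computes an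
orthonormal basis of the row space of `Q_k(T)` in TT form, and the coefficients of `Q_k(T)` in it.
[cite: Oseledets2011, §3, Alg. 2] [cite: UschmajewVandereycken2020, §3.1 (24)-(25)]
[cite: Schollwoeck2011AnnPhys, §4.4.2] -/
theorem rightInterface_eq_orthSweep_mul : ∀ (m k : ℕ) (h : k + m = L),
    T.rightInterface k m h =
      (T.orthSweep m k h).2 * (T.orthSweep m k h).1.rightInterface 0 m (Nat.zero_add m)
  | 0, k, h => by
      ext α t
      have h1 : ((T.orthSweep 0 k h).2 *
          (T.orthSweep 0 k h).1.rightInterface 0 0 (Nat.zero_add 0)) α t =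
            ∑ β : Fin 1, T.rbdry (α.cast (congrArg T.r h)) * (1 : ℝ) := rfl
      rw [h1, Fin.sum_univ_one, mul_one, rightInterface_zero]
  | m + 1, k, h => by
      rw [orthSweep]
      exact T.rightInterface_eq_orthStep_mul k _ h (rightInterface_eq_orthSweep_mul m (k + 1) _)

/-- THE NEW BOND DIMENSION IS THE RANK OF THE RIGHT INTERFACE: with `m ≥ 1` sites processed, the
left bond dimension of the sweep's train is `rank Q_k(T)` (`= rank` of the carried factor `R`, which
has full column rank).  [cite: UschmajewVandereycken2020, §3.1] [cite: Oseledets2011, §3, Alg. 2] -/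
theorem orthSweep_r_zero_eq_rank : ∀ (m k : ℕ) (h : k + m = L), 0 < m →
    (T.orthSweep m k h).1.r 0 = (T.rightInterface k m h).rank
  | 0, _, _, hm => absurd hm (lt_irrefl 0)
  | m + 1, k, h, _ => by
      rw [T.rightInterface_eq_orthSweep_mul (m + 1) k h, rank_mul_eq_of_mul_transpose_self _ _
        (T.orthSweep_rightInterface_mul_transpose_self (m + 1) k h 0 (m + 1) (Nat.zero_add _))]
      rw [orthSweep]
      exact (rank_mul_transpose_rowBasis _).symm

/-- The bond `j` of the sweep's train is `rank Q_{k+j}(T)` whenever at least one site lies to its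
right (`j + n = m`, `0 < n`).  [cite: UschmajewVandereycken2020, §3.1] -/
theorem orthSweep_r_eq_rank : ∀ (j m k : ℕ) (h : k + m = L) (k' n : ℕ), k + j = k' → j + n = m →
    ∀ (h' : k' + n = L), 0 < n → (T.orthSweep m k h).1.r j = (T.rightInterface k' n h').rank
  | 0, m, k, h, k', n, hk, hn, h', hn0 => by
      subst hk
      have e : m = n := by omega
      subst e
      exact T.orthSweep_r_zero_eq_rank m k h hn0
  | j + 1, m, k, h, k', n, hk, hn, h', hn0 => by
      obtain ⟨m, rfl⟩ : ∃ m', m = m' + 1 := ⟨j + n, by omega⟩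
      rw [orthSweep]
      exact orthSweep_r_eq_rank j m (k + 1) (by omega) k' n (by omega) (by omega) h' hn0

/-! ## Right-orthogonalisation of a train -/

/-- RIGHT-TO-LEFT ORTHOGONALISATION (the first loop of Algorithm 2; Algorithm "Right-to-Left
Orthogonalization"): sweep over the sites `L - 1, …, 1` (`orthSweep` down to `k = 1`) and absorb
the last carried factor into the first core, `G_0(a) := G_0(a) · R_1` — "we do not orthogonalize the
first core".  The result has the same length, the same left bond `r_0` and left boundary vector,
right-orthonormal cores at the sites `0 < j < L`, last bond `1` and right boundary vector `1`, and
represents the same tensor (`eval_rightOrthogonalize`); its interior bonds are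
`r'_k = rank Q_k(T) ≤ r_k` (`rightOrthogonalize_r_eq_rank`).  A train with no sites is returned
unchanged.  [cite: Oseledets2011, §3, Alg. 2]
[cite: DaasEtAl2021, §2.3, Alg. "Right-to-Left Orthogonalization"]
[cite: UschmajewVandereycken2020, §3.1] [cite: Schollwoeck2011AnnPhys, §4.4.2] -/
noncomputable def rightOrthogonalize : {L : ℕ} → TensorTrain ℝ σ L → TensorTrain ℝ σ L
  | 0, T => T
  | L + 1, T =>
      (T.orthSweep L 1 (Nat.add_comm 1 L)).1.cons rfl
        (fun a => T.core 0 a * (T.orthSweep L 1 (Nat.add_comm 1 L)).2) T.lbdry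

omit [Fintype σ] in
/-- The left bond dimension is kept.  [cite: DaasEtAl2021, §2.3] -/
@[simp] theorem rightOrthogonalize_r_zero [Fintype σ] : T.rightOrthogonalize.r 0 = T.r 0 := by
  match L, T with
  | 0, _ => rfl
  | _ + 1, _ => rfl

/-- The left boundary vector is kept (read through the identification of the left bond
dimensions `rightOrthogonalize_r_zero`).  [cite: DaasEtAl2021, §2.3] -/
theorem rightOrthogonalize_lbdry (α : Fin (T.rightOrthogonalize.r 0)) :
    T.rightOrthogonalize.lbdry α = T.lbdry (α.cast T.rightOrthogonalize_r_zero) := by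
  match L, T, α with
  | 0, _, _ => rfl
  | _ + 1, _, _ => rfl

/-- The last bond dimension becomes `1`.  [cite: Oseledets2011, §3, Alg. 2] -/
theorem rightOrthogonalize_r_last (hL : 0 < L) : T.rightOrthogonalize.r L = 1 := by
  match L, T, hL with
  | L + 1, T, _ => exact T.orthSweep_r_last L 1 (Nat.add_comm 1 L)

/-- The right boundary vector becomes `1`.  [cite: Oseledets2011, §3, Alg. 2] -/
theorem rightOrthogonalize_rbdry (hL : 0 < L) : T.rightOrthogonalize.rbdry = fun _ => 1 := by
  match L, T, hL with
  | L + 1, T, _ => exact T.orthSweep_rbdry L 1 (Nat.add_comm 1 L)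

/-- THE OUTPUT IS RIGHT-ORTHONORMAL at every site `0 < j < L`: `∑ a, G'_j(a) G'_j(a)ᵀ = 1` (its
horizontal unfoldings have orthonormal rows — "right orthogonal … for `n = 2, …, N` (all except the
first core)").  [cite: DaasEtAl2021, §2.3, Alg. "Right-to-Left Orthogonalization"]
[cite: Oseledets2011, §3, Alg. 2] [cite: UschmajewVandereycken2020, §3.1 (25)] -/
theorem rightOrthogonalize_core_mul_transpose_core (j : ℕ) (hj : 0 < j) (hjL : j < L) :
    ∑ a, T.rightOrthogonalize.core j a * (T.rightOrthogonalize.core j a)ᵀ = 1 := by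
  match L, T, j, hj, hjL with
  | L + 1, T, j + 1, _, hjL =>
      exact T.orthSweep_core_mul_transpose_core L 1 (Nat.add_comm 1 L) j (by omega)

/-- Hence the right interfaces `Q_k`, `0 < k`, of the output have orthonormal rows — the three
hypotheses (`r_L = 1`, `rbdry = 1`, right-orthonormal at `0 < j < L`) under which the guarantees of
`TensorTrainRounding` hold.  [cite: UschmajewVandereycken2020, §3.1 (24)-(25)] -/
theorem rightOrthogonalize_rightInterface_mul_transpose_self (k m : ℕ) (h : k + m = L)
    (hk : 0 < k) :
    T.rightOrthogonalize.rightInterface k m h * (T.rightOrthogonalize.rightInterface k m h)ᵀ = 1 :=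
  T.rightOrthogonalize.rightInterface_mul_transpose_self (T.rightOrthogonalize_r_last (by omega))
    (T.rightOrthogonalize_rbdry (by omega)) m k h
    fun j hj hjL => T.rightOrthogonalize_core_mul_transpose_core j (by omega) hjL

/-- Past the first site the right interfaces of the orthogonalised train are those of the sweep's
train: `Q_{k+1}(rightOrthogonalize T) = Q_k(B)`.  [cite: UschmajewVandereycken2020, §3.1 (22)] -/
theorem rightOrthogonalize_rightInterface_succ {L : ℕ} (T : TensorTrain ℝ σ (L + 1)) (k m : ℕ)
    (h : k + 1 + m = L + 1) :
    T.rightOrthogonalize.rightInterface (k + 1) m h =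
      (T.orthSweep L 1 (Nat.add_comm 1 L)).1.rightInterface k m (by omega) :=
  rightInterface_cons_succ _ _ _ _ k m h

/-- ORTHOGONALISATION DOES NOT CHANGE THE TENSOR: `rightOrthogonalize T` and `T` have the same
value at every configuration ("a right orthogonal TT-tensor equivalent to" the input) — by the sweep
invariant at the bond `1`, `Q_1(T) = R_1 Q_0(B)`, and `G_0(a) Q_1 = (G_0(a) R_1) Q_0(B)`.
[cite: DaasEtAl2021, §2.3, Alg. "Right-to-Left Orthogonalization"] [cite: Oseledets2011, §3, Alg. 2]
-/
theorem eval_rightOrthogonalize (s : Fin L → σ) : T.rightOrthogonalize.eval s = T.eval s := by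
  match L, T, s with
  | 0, _, _ => rfl
  | L + 1, T, s =>
      obtain ⟨a, s, rfl⟩ : ∃ a s', s = Fin.cons a s' :=
        ⟨s 0, Fin.tail s, (Fin.cons_self_tail s).symm⟩
      rw [eval_eq_lbdry_mul_rightInterface T 0,
        eval_eq_lbdry_mul_rightInterface T.rightOrthogonalize 0, Matrix.mul_apply,
        Matrix.mul_apply]
      simp only [Matrix.of_apply, rightInterface_cons]
      rw [T.rightInterface_eq_orthSweep_mul L 1 (Nat.add_comm 1 L),
        T.rightOrthogonalize_rightInterface_succ 0 L]
      refine Finset.sum_congr rfl fun α _ => ?_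
      rw [← Matrix.mul_assoc]
      rfl

/-- Hence all unfoldings agree.  [cite: UschmajewVandereycken2020, §3.1 (23)] -/
theorem evalUnfolding_rightOrthogonalize (k m : ℕ) (h : k + m = L) :
    T.rightOrthogonalize.evalUnfolding k m h = T.evalUnfolding k m h := by
  ext s t
  simp only [evalUnfolding_apply, eval_rightOrthogonalize]

/-- THE NEW BONDS ARE THE RANKS OF THE RIGHT INTERFACES: `r'_k = rank Q_k(T)` for `0 < k`,
`k + m = L`, `0 < m` (the LQ steps are rank-revealing).  [cite: UschmajewVandereycken2020, §3.1]
[cite: Oseledets2011, §3, Alg. 2] -/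
theorem rightOrthogonalize_r_eq_rank (k m : ℕ) (h : k + m = L) (hk : 0 < k) (hm : 0 < m) :
    T.rightOrthogonalize.r k = (T.rightInterface k m h).rank := by
  match L, T, k, hk, h with
  | 0, _, k, hk, h => exact absurd h (by omega)
  | L + 1, T, 0, hk, _ => exact absurd hk (lt_irrefl 0)
  | L + 1, T, k + 1, _, h =>
      exact T.orthSweep_r_eq_rank k L 1 (Nat.add_comm 1 L) (k + 1) m (Nat.add_comm 1 k)
        (by omega) h hm

/-- ORTHOGONALISATION NEVER INCREASES A BOND: `r'_k ≤ r_k` (`0 < k < L`; the bonds `0` and `L` are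
`r_0` and `1`).  [cite: Oseledets2011, §3, Alg. 2] [cite: UschmajewVandereycken2020, §3.1] -/
theorem rightOrthogonalize_r_le (k : ℕ) (hk : 0 < k) (hkL : k < L) :
    T.rightOrthogonalize.r k ≤ T.r k := by
  rw [T.rightOrthogonalize_r_eq_rank k (L - k) (by omega) hk (by omega)]
  exact (Matrix.rank_le_card_height _).trans_eq (Fintype.card_fin _)

/-- … and never drops below the TT-rank: `rank T_⟨k⟩ ≤ r'_k` (as for every representation).
[cite: UschmajewVandereycken2020, §3.1 Thm 12.2 (22)] -/
theorem rank_evalUnfolding_le_rightOrthogonalize_r (k m : ℕ) (h : k + m = L) :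
    (T.evalUnfolding k m h).rank ≤ T.rightOrthogonalize.r k := by
  rw [← T.evalUnfolding_rightOrthogonalize k m h]
  exact T.rightOrthogonalize.rank_evalUnfolding_le k m h

/-- A BOND THAT IS ALREADY MINIMAL IS KEPT: if `rank T_⟨k⟩ = r_k` (`0 < k < L`) then `r'_k = r_k`
(so on a minimal representation the sweep is a pure gauge fixing, cf.
`TensorTrain.exists_gauge_orthogonal`).  [cite: UschmajewVandereycken2020, §3.3]
[cite: HoltzRohwedderSchneider2011, §3] -/
theorem rightOrthogonalize_r_eq_of_rank_eq (k m : ℕ) (h : k + m = L) (hk : 0 < k) (hm : 0 < m)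
    (hmin : (T.evalUnfolding k m h).rank = T.r k) : T.rightOrthogonalize.r k = T.r k := by
  rw [T.rightOrthogonalize_r_eq_rank k m h hk hm, T.rank_rightInterface_eq k m h hmin]

/-- THE NORM FROM THE FIRST CORE: under the boundary convention `r_0 = 1`, `lbdry = 1`, after
right-orthogonalisation the Frobenius norm of the tensor is that of the first core,
`∑_s T(s)² = ∑_a ‖G'_0(a)‖²_F` (the train is `0`-orthogonal; this is how Algorithm 2 obtains `‖A‖_F`
for its truncation threshold).  [cite: UschmajewVandereycken2020, §3.1 (24)]
[cite: Oseledets2011, §3, Alg. 2] [cite: Schollwoeck2011AnnPhys, §4.4] -/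
theorem sum_sq_eval_eq_sum_sq_core_rightOrthogonalize [DecidableEq σ] (h0 : T.r 0 = 1)
    (hl : T.lbdry = fun _ => 1) (hL : 0 < L) :
    ∑ s, T.eval s ^ 2 = ∑ a, ∑ α, ∑ β, T.rightOrthogonalize.core 0 a α β ^ 2 := by
  have h := T.rightOrthogonalize.sum_sq_eval_eq_sum_sq_core
    (by rw [rightOrthogonalize_r_zero]; exact h0) (T.rightOrthogonalize_r_last hL)
    (by funext α; rw [rightOrthogonalize_lbdry, hl]) (T.rightOrthogonalize_rbdry hL) 0 hL
    (fun j hj => absurd hj (Nat.not_lt_zero j))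
    fun j hj hjL => T.rightOrthogonalize_core_mul_transpose_core j hj hjL
  simpa only [eval_rightOrthogonalize] using h

/-- The TT-RANKS of (the tensor of) `T` as a cap function: `ttRanks T k = rank T_⟨k⟩` for `k ≤ L`
(and `0` beyond).  [cite: UschmajewVandereycken2020, §3.1 Thm 12.2] -/
noncomputable def ttRanks (k : ℕ) : ℕ :=
  if h : k ≤ L then (T.evalUnfolding k (L - k) (by omega)).rank else 0

/-- `ttRanks T k = rank T_⟨k⟩` for every splitting `k + m = L`.
[cite: UschmajewVandereycken2020, §3.1 Thm 12.2] -/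
theorem ttRanks_eq (k m : ℕ) (h : k + m = L) : T.ttRanks k = (T.evalUnfolding k m h).rank := by
  obtain rfl : m = L - k := by omega
  rw [ttRanks, dif_pos (show k ≤ L by omega)]

end Orthogonalize

end TensorTrain

/-! ## TT-rounding of an arbitrary train: `ttRound ∘ rightOrthogonalize` -/

section RoundAll

variable {σ : Type*} [Fintype σ] [DecidableEq σ] (rk : ℕ → ℕ) {L : ℕ} (T : TensorTrain ℝ σ L)

/-- ALGORITHM 2 ON AN ARBITRARY TRAIN — A-POSTERIORI ERROR IDENTITY: the squared error of
TT-rounding (orthogonalise right-to-left, then truncate left-to-right with the SVD rule) is EXACTLY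
the accumulated local loss of the truncation sweep.  [cite: Oseledets2011, §3, Alg. 2]
[cite: Schollwoeck2011AnnPhys, §4.5.1] -/
theorem sum_sq_sub_eval_ttRound_rightOrthogonalize_eq_loss (hL : 0 < L) :
    ∑ s, (T.eval s - (ttRound (localSvdSel rk) T.rightOrthogonalize).eval s) ^ 2 =
      ttRoundLoss (localSvdSel rk) T.rightOrthogonalize := by
  have h := sum_sq_sub_eval_ttRound_eq_loss rk T.rightOrthogonalize
    (T.rightOrthogonalize_r_last hL) (T.rightOrthogonalize_rbdry hL)
    fun j hj hjL => T.rightOrthogonalize_core_mul_transpose_core j hj hjL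
  simpa only [TensorTrain.eval_rightOrthogonalize] using h

/-- ALGORITHM 2 ON AN ARBITRARY TRAIN — THE ERROR BOUND: if every unfolding `T_⟨k⟩`, `0 < k < L`,
is within squared Frobenius distance `b k` of a matrix of rank `≤ rk k`, then
`‖T - ttRound (localSvdSel rk) (rightOrthogonalize T)‖²_F ≤ ∑_{0<k<L} b k` — with
`b k = ε₀² ‖T‖² / (L - 1)`, "the resulting tensor satisfies `‖X - Y‖ ≤ ε₀ ‖X‖`", now for EVERY
input train.  [cite: Oseledets2011, §2–§3] [cite: OseledetsTyrtyshnikov2010, Thm 2.2]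
[cite: DaasEtAl2021, §2.3, Alg. "TT-Rounding"] [cite: UschmajewVandereycken2020, §3.2] -/
theorem sum_sq_sub_eval_ttRound_rightOrthogonalize_le (hL : 0 < L) (b : ℕ → ℝ)
    (hb : ∀ (k m : ℕ) (h : k + m = L), 0 < k → 0 < m →
      ∃ R : Matrix (Fin k → σ) (Fin m → σ) ℝ, R.rank ≤ rk k ∧
        ∑ s, ∑ t, (T.evalUnfolding k m h - R) s t ^ 2 ≤ b k) :
    ∑ s, (T.eval s - (ttRound (localSvdSel rk) T.rightOrthogonalize).eval s) ^ 2 ≤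
      ∑ k ∈ Finset.Ico 1 L, b k := by
  have h := sum_sq_sub_eval_ttRound_le rk T.rightOrthogonalize (T.rightOrthogonalize_r_last hL)
    (T.rightOrthogonalize_rbdry hL)
    (fun j hj hjL => T.rightOrthogonalize_core_mul_transpose_core j hj hjL) b
    fun k m h hk hm => by
      rw [T.evalUnfolding_rightOrthogonalize k m h]
      exact hb k m h hk hm
  simpa only [TensorTrain.eval_rightOrthogonalize] using h

/-- THE ERROR BOUND BY SINGULAR VALUES, for every input train:
`‖T - ttRound (localSvdSel rk) (rightOrthogonalize T)‖²_F ≤ ∑_{0<k<L} ∑_{j ≥ rk k} σ_j(T_⟨k⟩)²`.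
[cite: Oseledets2011, §2–§3] [cite: OseledetsTyrtyshnikov2010, Thm 2.2]
[cite: GolubVanLoan2013, §2.4.2] -/
theorem sum_sq_sub_eval_ttRound_rightOrthogonalize_le_of_singularValues (hL : 0 < L) (τ : ℕ → ℝ)
    (hτ : ∀ (k m : ℕ) (h : k + m = L), 0 < k → 0 < m →
      ∑ j ∈ Finset.Ico (rk k) (Fintype.card (Fin m → σ)),
        (Matrix.toEuclideanLin (T.evalUnfolding k m h)).singularValues j ^ 2 ≤ τ k) :
    ∑ s, (T.eval s - (ttRound (localSvdSel rk) T.rightOrthogonalize).eval s) ^ 2 ≤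
      ∑ k ∈ Finset.Ico 1 L, τ k := by
  have h := sum_sq_sub_eval_ttRound_le_of_singularValues rk T.rightOrthogonalize
    (T.rightOrthogonalize_r_last hL) (T.rightOrthogonalize_rbdry hL)
    (fun j hj hjL => T.rightOrthogonalize_core_mul_transpose_core j hj hjL) τ
    fun k m h hk hm => by
      rw [T.evalUnfolding_rightOrthogonalize k m h]
      exact hτ k m h hk hm
  simpa only [TensorTrain.eval_rightOrthogonalize] using h

/-- QUASI-OPTIMALITY OF ALGORITHM 2, for every input train:
`‖T - ttRound (localSvdSel rk) (rightOrthogonalize T)‖²_F ≤ (L - 1) · ‖T - T'‖²_F` for every train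
`T'` with bonds `T'.r k ≤ rk k` (`0 < k < L`).  [cite: Oseledets2011, §2–§3]
[cite: UschmajewVandereycken2020, §3.2 (28)–(30)] -/
theorem sum_sq_sub_eval_ttRound_rightOrthogonalize_le_mul (hL : 0 < L) (T' : TensorTrain ℝ σ L)
    (hT' : ∀ k, 0 < k → k < L → T'.r k ≤ rk k) :
    ∑ s, (T.eval s - (ttRound (localSvdSel rk) T.rightOrthogonalize).eval s) ^ 2 ≤
      ((L - 1 : ℕ) : ℝ) * ∑ s, (T.eval s - T'.eval s) ^ 2 := by
  have h := sum_sq_sub_eval_ttRound_le_mul rk T.rightOrthogonalize (T.rightOrthogonalize_r_last hL)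
    (T.rightOrthogonalize_rbdry hL)
    (fun j hj hjL => T.rightOrthogonalize_core_mul_transpose_core j hj hjL) T' hT'
  simpa only [TensorTrain.eval_rightOrthogonalize] using h

/-- ALGORITHM 2 IS EXACT BELOW THE CAPS, for every input train: if `rank T_⟨k⟩ ≤ rk k` for all
`0 < k < L` then `ttRound (localSvdSel rk) (rightOrthogonalize T)` represents the same tensor as
`T`.  [cite: Oseledets2011, §2–§3] [cite: HoltzRohwedderSchneider2011, §3] -/
theorem eval_ttRound_rightOrthogonalize_eq (hL : 0 < L)
    (hrk : ∀ (k m : ℕ) (h : k + m = L), 0 < k → 0 < m → (T.evalUnfolding k m h).rank ≤ rk k)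
    (s : Fin L → σ) : (ttRound (localSvdSel rk) T.rightOrthogonalize).eval s = T.eval s := by
  rw [← T.eval_rightOrthogonalize s]
  exact eval_ttRound_eq rk T.rightOrthogonalize (T.rightOrthogonalize_r_last hL)
    (T.rightOrthogonalize_rbdry hL)
    (fun j hj hjL => T.rightOrthogonalize_core_mul_transpose_core j hj hjL)
    (fun k m h hk hm => by
      rw [T.evalUnfolding_rightOrthogonalize k m h]
      exact hrk k m h hk hm) s

/-- In particular rounding with caps `rk k ≥ T.r k` reproduces the tensor of ANY train exactly.
[cite: Oseledets2011, §3] [cite: UschmajewVandereycken2020, §3.2] -/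
theorem eval_ttRound_rightOrthogonalize_eq_of_r_le (hL : 0 < L)
    (hrk : ∀ k, 0 < k → k < L → T.r k ≤ rk k) (s : Fin L → σ) :
    (ttRound (localSvdSel rk) T.rightOrthogonalize).eval s = T.eval s :=
  eval_ttRound_rightOrthogonalize_eq rk T hL
    (fun k m h hk hm => (T.rank_evalUnfolding_le k m h).trans (hrk k hk (by omega))) s

omit [DecidableEq σ] in
/-- THE BONDS OF THE ROUNDED TRAIN: `≤ min (rk k) (rank Q_k(T))` at every interior bond — capped by
the rule and by the bonds of the orthogonalised train.  [cite: Oseledets2011, §3, Alg. 2]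
[cite: UschmajewVandereycken2020, §3.2] -/
theorem ttRound_rightOrthogonalize_r_le (k : ℕ) (hk : 0 < k) (hkL : k < L) :
    (ttRound (localSvdSel rk) T.rightOrthogonalize).r k ≤
      min (rk k) ((T.rightInterface k (L - k) (by omega)).rank) := by
  rw [← T.rightOrthogonalize_r_eq_rank k (L - k) (by omega) hk (by omega)]
  exact ttRound_r_le rk T.rightOrthogonalize k hk hkL

omit [DecidableEq σ] in
/-- … in particular `≤ min (rk k) (T.r k)`: TT-rounding never increases a bond of any train.
[cite: Oseledets2011, §3, Alg. 2] -/
theorem ttRound_rightOrthogonalize_r_le_min (k : ℕ) (hk : 0 < k) (hkL : k < L) :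
    (ttRound (localSvdSel rk) T.rightOrthogonalize).r k ≤ min (rk k) (T.r k) :=
  (ttRound_r_le rk T.rightOrthogonalize k hk hkL).trans
    (min_le_min_left _ (T.rightOrthogonalize_r_le k hk hkL))

/-! ## Recompression to the TT-ranks -/

/-- TT-RECOMPRESSION: Algorithm 2 with the caps `rk k = rank T_⟨k⟩` — right-orthogonalise, then
round to the TT-ranks of the tensor.  [cite: Oseledets2011, §3, Alg. 2]
[cite: HoltzRohwedderSchneider2011, §3] -/
noncomputable def ttCompress (T : TensorTrain ℝ σ L) : TensorTrain ℝ σ L :=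
  ttRound (localSvdSel T.ttRanks) T.rightOrthogonalize

/-- RECOMPRESSION IS EXACT: `ttCompress T` represents the same tensor as `T`.
[cite: Oseledets2011, §3] [cite: HoltzRohwedderSchneider2011, §3] -/
theorem eval_ttCompress (hL : 0 < L) (s : Fin L → σ) : (ttCompress T).eval s = T.eval s :=
  eval_ttRound_rightOrthogonalize_eq T.ttRanks T hL
    (fun k m h _ _ => (T.ttRanks_eq k m h).symm.le) s

/-- RECOMPRESSION ATTAINS THE TT-RANKS: the interior bonds of `ttCompress T` are exactly
`rank T_⟨k⟩` (`k + m = L`, `0 < k`, `0 < m`).  [cite: Oseledets2011, §3]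
[cite: UschmajewVandereycken2020, §3.1 Thm 12.2] [cite: HoltzRohwedderSchneider2011, §3] -/
theorem ttCompress_r_eq_rank (k m : ℕ) (h : k + m = L) (hk : 0 < k) (hm : 0 < m) :
    (ttCompress T).r k = (T.evalUnfolding k m h).rank := by
  refine le_antisymm ?_ ?_
  · exact (ttRound_r_le T.ttRanks T.rightOrthogonalize k hk (by omega)).trans
      ((min_le_left _ _).trans_eq (T.ttRanks_eq k m h))
  · have h2 := (ttCompress T).rank_evalUnfolding_le k m h
    have hU : (ttCompress T).evalUnfolding k m h = T.evalUnfolding k m h := by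
      ext s t
      simp only [TensorTrain.evalUnfolding_apply, eval_ttCompress T (by omega)]
    rwa [hU] at h2

/-- THE TT-RANKS ARE MINIMAL AND ATTAINED: every train `T'` representing the same tensor has
interior bonds at least those of `ttCompress T`.  [cite: UschmajewVandereycken2020, §3.1 Thm 12.2]
[cite: HoltzRohwedderSchneider2011, §3] -/
theorem ttCompress_r_le_of_eval_eq (T' : TensorTrain ℝ σ L) (hT' : ∀ s, T'.eval s = T.eval s)
    (k : ℕ) (hk : 0 < k) (hkL : k < L) : (ttCompress T).r k ≤ T'.r k := by
  rw [ttCompress_r_eq_rank T k (L - k) (by omega) hk (by omega)]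
  have hU : T.evalUnfolding k (L - k) (by omega) = T'.evalUnfolding k (L - k) (by omega) := by
    ext s t
    simp only [TensorTrain.evalUnfolding_apply, hT']
  rw [hU]
  exact T'.rank_evalUnfolding_le k (L - k) _

omit [DecidableEq σ] in
/-- The recompressed train is in the boundary convention `r_0 = 1`, `lbdry = 1` …
[cite: Oseledets2011, §3, Alg. 2] -/
theorem ttCompress_r_zero : (ttCompress T).r 0 = 1 := ttRound_r_zero _ _

omit [DecidableEq σ] in
/-- … `r_L = 1` (`L ≥ 1`) …  [cite: Oseledets2011, §3, Alg. 2] -/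
theorem ttCompress_r_last (hL : 0 < L) : (ttCompress T).r L = 1 := ttRound_r_last _ _ hL

omit [DecidableEq σ] in
/-- … and LEFT-orthonormal at the sites `j + 1 < L`.  [cite: Oseledets2011, §3, Alg. 2]
[cite: HoltzRohwedderSchneider2011, §3] -/
theorem ttCompress_transpose_core_mul_core (j : ℕ) (hj : j + 1 < L) :
    ∑ a, ((ttCompress T).core j a)ᵀ * (ttCompress T).core j a = 1 :=
  ttRound_localSvdSel_transpose_core_mul_core _ _ j hj

end RoundAll

end Literature.LinearAlgebra.TensorNetworks
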